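import Summits.ValiantsHypothesis.ValiantsHypothesis.Theorems.LacunarySymmetroidMatrixDescartesNsdPivotLoneRankOne
import Summits.ValiantsHypothesis.ValiantsHypothesis.Theorems.LacunarySymmetroidMatrixDescartesPivotDefiniteGraded

/-!
# `MatrixDescartes` (stmt-ValiantsHypothesis-18050) — NSD pivot, EVERY SIZE: a SINGULAR lone letter costs one root
# (the definite-pivot graded law minus one; the W-pencil with `J ⪯ 0` and singular top letter: `≤ 13` at `n = 3`)

HONEST FRAMING.  Cell `pub-symmetroid`, seat `val-sym-mdr-p2` (gen 27); helper file `--supports` the crux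
`Theses.LacunarySymmetroid.MatrixDescartes` (OPEN), NO closure claim.  Companion of `…NsdPivotLoneRankOne` (this seat, same day: the `2 × 2`
case) and of gen 26's `…PivotDefiniteGraded` (`negSemidef_pivot_graded`: `J = −WWᵀ ⪯ 0`, PSD letters ⇒
`Z₊ ≤ 2·∑_{j odd ≤ min r m} C(K + m − j − 1, K − 1)`).  The same END LAW one size up:

* `coeff_det_topNext_lone_above` / `coeff_det_eq_zero_above` (any size `m + 1`, any pivot `J`): with ONE letter `k₀` strictly above the
  pivot exponent and all others strictly below, the coefficient of `X^{e + m·d k₀}` in `det` is `tr(adj P_{k₀} · J)` and, if `det P_{k₀} = 0`,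
  nothing lies above it (tree `PencilEnds.coeff_det_pencil_top / topNext / lt_topNext_of_mem_support`, gen 26).
* **`negSemidef_pivot_graded_succ_of_lone_above`**: `J = −WWᵀ` (`W` real `(m+1) × r`, `r ≥ 1`), PSD letters, support `(K−1 | 1)` with a
  SINGULAR lone upper letter ⇒ **`Z₊ + 1 ≤ 2·∑_{j odd ≤ min r (m+1)} C(K + m − j, K − 1)`** — gen 26's budget minus one: the top exponent
  `e + m·d k₀` is the odd level `j = 1` (multiset `{k₀,…,k₀}`), its coefficient `−tr(adj P_{k₀}·WWᵀ) ≤ 0`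
  (`TrailingCoeffs.trace_adjugate_mul_nonneg`), so the last negative run is never left (`NsdLoneRankOne.card_posRoots_succ_le_two_mul_card`);
  the negative-support part is gen 26's Cauchy–Binet argument verbatim (`negSemidef_pivot_graded_succ_of_top`).
* **`negSemidef_pivot_graded_succ_of_lone_below`**: the mirror `(1 | K−1)` (`Pivot.Reverse.pivotPosRoots_reverse`).
* W-currency: **`wNsd_succ_le_of_singular_top`** — a W-pencil `X^e J + X^{d₁}P₁ + X^{d₂}P₂ + X^{d₃}Q` of size `m + 1` with `d₂ < d₁ < e < d₃`,
  `J ⪯ 0`, `P₁, P₂, Q ⪰ 0` and `det Q = 0` has `Z₊ + 1 ≤ 2·∑_{j odd ≤ m+1} C(m + 3 − j, 2)`; **`wNsd_three_le_thirteen_of_singular_top`**: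
  at `n = 3` this is `13` (gen 26's `wNsd_three_le_fourteen'` gives `14`; the ten-root witness `…WLawThreeWitness` has a FULL-RANK top
  letter, so the definite sub-column of `w(3)` stays `[10, 14]` and its singular-`Q` sub-row is `≤ 13`); at `n = 2` the same law
  gives the `5` of `…NsdPivotLoneRankOne` (`NsdLoneRankOne.wNsd_two_le_five_of_rankOne_top`, proved there directly and shown EXACT).
Nothing here bears on `MatrixDescartes` in its window, on `stub_twoSided`, on `DoorA26` / `DoorA34`, on the cell's registers, or on `VP ≠ VNP`.

[folklore] Cauchy–Binet sign bookkeeping (gen 26, copied with the budget lemma replaced) + the leading-coefficient identities of `…PencilEnds`;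
no definitions, no named facts.
-/

-- `Summit.ValiantsHypothesis.ValiantsHypothesis.…` repeats a component by the D-0017 layout
-- (single-conjunct summit), which the `dupNamespace` linter flags; the name is mandated.
set_option linter.dupNamespace false

namespace Summit.ValiantsHypothesis.ValiantsHypothesis.Theorems.LacunarySymmetroidMatrixDescartes.Pivot.NsdLoneSingular

open Polynomial Matrix Finset IndexGraded
open scoped BigOperators MatrixOrder

variable {m K q : ℕ}

/-! ## 1. Leading coefficients of a pivot pencil with a lone upper letter (any size `m + 1`) -/

/-- **Top coefficient, any size.**  Lone letter `k₀` strictly above the pivot, all others strictly below: the coefficient of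
`X^{e + m·d k₀}` in `det (X^e J + ∑ X^{dₖ} Pₖ)` (size `m + 1`) is `tr(adj P_{k₀} · J)`.  (The `m = 1` case is
`NsdLoneRankOne.coeff_det_top_eq`.) [folklore] -/
theorem coeff_det_topNext_lone_above (e : ℕ) (d : Fin K → ℕ) (J : Matrix (Fin (m + 1)) (Fin (m + 1)) ℝ)
    (P : Fin K → Matrix (Fin (m + 1)) (Fin (m + 1)) ℝ) (k₀ : Fin K) (htop : e < d k₀) (hlow : ∀ k, k ≠ k₀ → d k < e) :
    (Matrix.det (((X : ℝ[X]) ^ e) • J.map Polynomial.C + ∑ k, ((X : ℝ[X]) ^ d k) • (P k).map Polynomial.C)).coeff (e + m * d k₀)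
      = ((P k₀).adjugate * J).trace := by
  have h := PencilEnds.coeff_det_pencil_topNext (Fin.cons e d : Fin (K + 1) → ℕ)
    (Fin.cons J P : Fin (K + 1) → Matrix (Fin (m + 1)) (Fin (m + 1)) ℝ) (k₀ := k₀.succ) (k₁ := 0)
    (by simpa using htop)
    (by
      intro l hl0 hl1
      obtain ⟨k, rfl⟩ := Fin.eq_succ_of_ne_zero hl1
      have hk : k ≠ k₀ := fun h => hl0 (by rw [h])
      simpa using hlow k hk)
  rw [Fin.sum_univ_succ] at h
  simp only [Fin.cons_succ, Fin.cons_zero] at h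
  rw [show e + m * d k₀ = m * d k₀ + e from Nat.add_comm _ _]
  exact h

/-- **Nothing above, any size.**  Same support hypotheses plus `det P_{k₀} = 0`: every coefficient above `e + m·d k₀` vanishes. [folklore] -/
theorem coeff_det_eq_zero_above (e : ℕ) (d : Fin K → ℕ) (J : Matrix (Fin (m + 1)) (Fin (m + 1)) ℝ)
    (P : Fin K → Matrix (Fin (m + 1)) (Fin (m + 1)) ℝ) (k₀ : Fin K) (htop : e < d k₀) (hlow : ∀ k, k ≠ k₀ → d k < e)
    (hrk : (P k₀).det = 0) {n : ℕ} (hn : e + m * d k₀ < n) :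
    (Matrix.det (((X : ℝ[X]) ^ e) • J.map Polynomial.C + ∑ k, ((X : ℝ[X]) ^ d k) • (P k).map Polynomial.C)).coeff n = 0 := by
  have h01 : (Fin.cons e d : Fin (K + 1) → ℕ) 0 < (Fin.cons e d : Fin (K + 1) → ℕ) k₀.succ := by simpa using htop
  have hnext : ∀ l : Fin (K + 1), l ≠ k₀.succ → l ≠ 0 →
      (Fin.cons e d : Fin (K + 1) → ℕ) l < (Fin.cons e d : Fin (K + 1) → ℕ) 0 := by
    intro l hl0 hl1
    obtain ⟨k, rfl⟩ := Fin.eq_succ_of_ne_zero hl1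
    have hk : k ≠ k₀ := fun h => hl0 (by rw [h])
    simpa using hlow k hk
  by_contra hne
  by_cases h2 : n = (m + 1) * d k₀
  · have htopc := PencilEnds.coeff_det_pencil_top (Fin.cons e d : Fin (K + 1) → ℕ)
      (Fin.cons J P : Fin (K + 1) → Matrix (Fin (m + 1)) (Fin (m + 1)) ℝ) (k₀ := k₀.succ)
      (by
        intro l hl
        by_cases hl1 : l = 0
        · rw [hl1]; exact h01
        · exact (hnext l hl hl1).trans h01)
    rw [Fin.sum_univ_succ] at htopc
    simp only [Fin.cons_succ, Fin.cons_zero] at htopc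
    apply hne
    rw [h2, htopc, hrk]
  · have hmem : n ∈ (Matrix.det (∑ l : Fin (K + 1), ((X : ℝ[X]) ^ (Fin.cons e d : Fin (K + 1) → ℕ) l) •
        ((Fin.cons J P : Fin (K + 1) → Matrix (Fin (m + 1)) (Fin (m + 1)) ℝ) l).map Polynomial.C)).support := by
      rw [Polynomial.mem_support_iff, Fin.sum_univ_succ]
      simp only [Fin.cons_succ, Fin.cons_zero]
      exact hne
    have hlt := PencilEnds.lt_topNext_of_mem_support (Fin.cons e d : Fin (K + 1) → ℕ)
      (Fin.cons J P : Fin (K + 1) → Matrix (Fin (m + 1)) (Fin (m + 1)) ℝ) h01 hnext hmem (by simpa using h2)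
      (by simp only [Fin.cons_succ, Fin.cons_zero]; omega)
    simp only [Fin.cons_succ, Fin.cons_zero] at hlt
    omega

/-! ## 2. Gen 26's graded count with one end -/

/-- **The definite-pivot graded law with a non-positive top** (size `m ≥ 1`, `J = −WWᵀ` with `r ≥ 1` columns, PSD letters, `K ≥ 1`):
if no coefficient of `det F` lies above `n₀ = e + (m − 1)·d k₀` and the coefficient there is `≤ 0`, then
`Z₊ + 1 ≤ 2·∑_{j odd ≤ min r m} C(K + m − j − 1, K − 1)`.  The negative-support part is gen 26's `negSemidef_pivot_graded` verbatim;
`n₀` is the odd level `j = 1`. [folklore] -/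
theorem negSemidef_pivot_graded_succ_of_top (e : ℕ) (d : Fin K → ℕ) (W : Matrix (Fin m) (Fin q) ℝ) (P : Fin K → Matrix (Fin m) (Fin m) ℝ)
    (hP : ∀ k, (P k).PosSemidef) (hK : 0 < K) (hq : 0 < q) (hm : 0 < m) (k₀ : Fin K) {n₀ : ℕ} (hn₀ : n₀ = e + (m - 1) * d k₀)
    (habove : ∀ n, n₀ < n → (Matrix.det (((X : ℝ[X]) ^ e) • (-(W * Wᵀ)).map Polynomial.C
        + ∑ k, ((X : ℝ[X]) ^ d k) • (P k).map Polynomial.C)).coeff n = 0)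
    (hle : (Matrix.det (((X : ℝ[X]) ^ e) • (-(W * Wᵀ)).map Polynomial.C
        + ∑ k, ((X : ℝ[X]) ^ d k) • (P k).map Polynomial.C)).coeff n₀ ≤ 0) :
    pivotPosRoots e d (-(W * Wᵀ)) P + 1
      ≤ 2 * ((Finset.range (min q m + 1)).filter (fun j => Odd j)).sum (fun j => Nat.choose (K + m - j - 1) (K - 1)) := by
  classical
  choose S hS using fun k => ResolventDescartes.exists_eq_mul_transpose (P k) (hP k)
  have hS₀ : -(W * Wᵀ) + W * Wᵀ = (0 : Matrix (Fin m) (Fin m) ℝ) * (0 : Matrix (Fin m) (Fin m) ℝ)ᵀ := by simp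
  unfold pivotPosRoots
  set σ := (Option (Fin K) × Fin m) ⊕ Fin q with hσ
  set ε : σ ≃ Fin (Fintype.card σ) := Fintype.equivFin σ with hε
  set sgσ : σ → ℝ := Sum.elim (fun _ => (1 : ℝ)) (fun _ => -1) with hsg
  set exσ : σ → ℕ := Sum.elim (fun oc => oc.1.elim e d) (fun _ => e) with hex
  -- the odd-level exponent set over the K letters only
  set T : Finset ℕ := ((Finset.range (min q m + 1)).filter (fun j => Odd j)).biUnion
      (fun j => (Finset.univ : Finset (Sym (Fin K) (m - j))).image
        (fun s : Sym (Fin K) (m - j) => j * e + ((s : Multiset (Fin K)).map d).sum)) with hT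
  have hTcard : T.card ≤ ((Finset.range (min q m + 1)).filter (fun j => Odd j)).sum (fun j => Nat.choose (K + m - j - 1) (K - 1)) := by
    refine Finset.card_biUnion_le.trans (Finset.sum_le_sum fun j hj => ?_)
    calc _ ≤ (Finset.univ : Finset (Sym (Fin K) (m - j))).card := Finset.card_image_le
      _ = Nat.choose (K + m - j - 1) (K - 1) := by
          rw [Finset.card_univ, Sym.card_sym_eq_choose, Fintype.card_fin]
          have hjm : j ≤ m := by have := Finset.mem_range.mp (Finset.mem_filter.mp hj).1; omega
          obtain ⟨K', rfl⟩ : ∃ K', K = K' + 1 := ⟨K - 1, by omega⟩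
          rw [show K' + 1 + (m - j) - 1 = K' + (m - j) by omega, show K' + 1 + m - j - 1 = K' + (m - j) by omega,
            show K' + 1 - 1 = K' by omega]
          exact Nat.choose_symm_add.symm
  -- the top exponent `e + (m − 1)·d k₀` is the odd level `j = 1` with the multiset `{k₀, …, k₀}`
  have hn₀T : e + (m - 1) * d k₀ ∈ T := by
    rw [hT]
    refine Finset.mem_biUnion.mpr ⟨1, Finset.mem_filter.mpr ⟨Finset.mem_range.mpr (by omega), odd_one⟩, ?_⟩
    refine Finset.mem_image.mpr ⟨Sym.replicate (m - 1) k₀, Finset.mem_univ _, ?_⟩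
    rw [Sym.coe_replicate, Multiset.map_replicate, Multiset.sum_replicate, smul_eq_mul, one_mul]
  rw [hn₀] at habove hle
  refine (NsdLoneRankOne.card_posRoots_succ_le_two_mul_card _ T (fun n hn => ?_) hn₀T habove hle).trans
    (Nat.mul_le_mul_left 2 hTcard)
  rw [pencil_eq_gram e d (-(W * Wᵀ)) P W 0 S hS₀ hS ε] at hn
  by_contra hnT
  refine absurd hn (not_lt.2 ?_)
  rw [GramExpansion.coeff_det_gramPencil]
  refine Finset.sum_nonneg fun t ht => ?_
  have htinj : Function.Injective t := (Finset.mem_filter.1 ht).2.injective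
  split_ifs with hsum
  swap
  · exact le_rfl
  -- a selection through a column of `S₀ = 0` has a zero column
  by_cases hzero : ∃ a c, ε.symm (t a) = Sum.inl (none, c)
  · obtain ⟨a, c, hac⟩ := hzero
    have hdet : (Matrix.of fun i a' => (Sum.elim (fun oc : Option (Fin K) × Fin m => fun i => (oc.1.elim (0 : Matrix (Fin m) (Fin m) ℝ) S) i oc.2)
        (fun c => fun i => W i c)) (ε.symm (t a')) i).det = 0 := by
      refine Matrix.det_eq_zero_of_column_eq_zero a fun i => ?_
      rw [Matrix.of_apply, hac]
      simp
    rw [hdet]; simp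
  push Not at hzero
  set A : Finset (Fin m) := Finset.univ.filter (fun a => ∃ c, ε.symm (t a) = Sum.inr c) with hA
  have hsign : ∏ a, sgσ (ε.symm (t a)) = (-1 : ℝ) ^ A.card := by
    rw [← Finset.prod_filter_mul_prod_filter_not Finset.univ (fun a => ∃ c, ε.symm (t a) = Sum.inr c), ← hA]
    have h1 : ∏ a ∈ A, sgσ (ε.symm (t a)) = (-1 : ℝ) ^ A.card := by
      rw [← Finset.prod_const]
      refine Finset.prod_congr rfl fun a ha => ?_
      obtain ⟨c, hc⟩ := (Finset.mem_filter.mp (hA ▸ ha)).2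
      rw [hc, hsg, Sum.elim_inr]
    have h2 : ∏ a ∈ Finset.univ.filter (fun a => ¬ ∃ c, ε.symm (t a) = Sum.inr c), sgσ (ε.symm (t a)) = 1 := by
      refine Finset.prod_eq_one fun a ha => ?_
      have hno := (Finset.mem_filter.mp ha).2
      rcases hx : ε.symm (t a) with oc | c
      · rw [hsg, Sum.elim_inl]
      · exact absurd ⟨c, hx⟩ hno
    rw [h1, h2, mul_one]
  by_cases hpar : Even A.card
  · change 0 ≤ (∏ a, sgσ (ε.symm (t a))) * _
    rw [hsign, hpar.neg_one_pow, one_mul]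
    exact sq_nonneg _
  · exfalso
    have hodd : Odd A.card := Nat.not_even_iff_odd.mp hpar
    -- the other rows select genuine letter columns `some k`
    have hother : ∀ a, a ∉ A → ∃ kc : Fin K × Fin m, ε.symm (t a) = Sum.inl (some kc.1, kc.2) := by
      intro a ha
      rcases hx : ε.symm (t a) with oc | c
      · rcases oc with ⟨o, c⟩
        rcases o with _ | k
        · exact absurd hx (hzero a c)
        · exact ⟨(k, c), rfl⟩
      · exact absurd (Finset.mem_filter.mpr ⟨Finset.mem_univ _, ⟨c, hx⟩⟩) (hA ▸ ha)
    obtain ⟨a₀, -⟩ := Finset.card_pos.mp hodd.pos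
    haveI : Nonempty (Fin K × Fin m) := ⟨(⟨0, hK⟩, a₀)⟩
    choose! kc hkc using hother
    set s : Multiset (Fin K) := (Finset.univ \ A).val.map (fun a => (kc a).1) with hs
    have hAq : A.card ≤ q := by
      rcases Nat.eq_zero_or_pos q with hq0 | hq0
      · subst hq0
        have : A = ∅ := by
          rw [Finset.eq_empty_iff_forall_notMem]
          intro a ha
          obtain ⟨c, _⟩ := (Finset.mem_filter.mp (hA ▸ ha)).2
          exact Fin.elim0 c
        rw [this, Finset.card_empty]
      · have hinj : ∀ a b, ε.symm (t a) = ε.symm (t b) → a = b := fun a b h => htinj (ε.symm.injective h)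
        let col : Fin m → Fin q := fun a => (ε.symm (t a)).elim (fun _ => ⟨0, hq0⟩) id
        have : A.card ≤ (Finset.univ : Finset (Fin q)).card := by
          refine Finset.card_le_card_of_injOn col (fun _ _ => Finset.mem_univ _) ?_
          intro a ha b hb hab
          obtain ⟨ca, hca⟩ := (Finset.mem_filter.mp (hA ▸ Finset.mem_coe.mp ha)).2
          obtain ⟨cb, hcb⟩ := (Finset.mem_filter.mp (hA ▸ Finset.mem_coe.mp hb)).2
          have hc : ca = cb := by simpa [col, hca, hcb] using hab
          exact hinj a b (by rw [hca, hcb, hc])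
        simpa using this
    have hscard : Multiset.card s = m - A.card := by
      rw [hs, Multiset.card_map, Finset.card_val, Finset.card_sdiff, Finset.inter_univ, Finset.card_univ, Fintype.card_fin]
    have hAm : A.card ≤ m := (Finset.card_le_univ A).trans (by rw [Fintype.card_fin])
    apply hnT
    rw [hT]
    refine Finset.mem_biUnion.mpr ⟨A.card, Finset.mem_filter.mpr ⟨Finset.mem_range.mpr ?_, hodd⟩, ?_⟩
    · have := Nat.le_min.mpr ⟨hAq, hAm⟩; omega
    refine Finset.mem_image.mpr ⟨⟨s, hscard⟩, Finset.mem_univ _, ?_⟩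
    rw [hsum, ← Finset.sum_filter_add_sum_filter_not Finset.univ (fun a => ∃ c, ε.symm (t a) = Sum.inr c), ← hA]
    have hneg : ∑ a ∈ A, exσ (ε.symm (t a)) = A.card * e := by
      rw [Finset.sum_const_nat fun a ha => ?_]
      obtain ⟨c, hc⟩ := (Finset.mem_filter.mp (hA ▸ ha)).2
      rw [hc, hex, Sum.elim_inr]
    have hset : Finset.univ.filter (fun a => ¬ ∃ c, ε.symm (t a) = Sum.inr c) = Finset.univ \ A := by
      ext a; simp [hA]
    have hpos : ∑ a ∈ Finset.univ.filter (fun a => ¬ ∃ c, ε.symm (t a) = Sum.inr c), exσ (ε.symm (t a))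
        = (s.map d).sum := by
      rw [hs, Multiset.map_map, Function.comp_def, ← Finset.sum_map_val, hset]
      refine Finset.sum_congr rfl fun a ha => ?_
      have ha' : a ∉ A := (Finset.mem_sdiff.mp ha).2
      rw [hkc a ha', hex, Sum.elim_inl]
      rfl
    change (A.card * e + (s.map d).sum) = _
    rw [hneg, hpos]

/-! ## 3. The singular lone letter costs one root, at every size -/

/-- **`(K−1 | 1)` with a SINGULAR lone upper letter, any size `m + 1`**: `J = −WWᵀ` (`r ≥ 1` columns), PSD letters `Pₖ` (`K ≥ 1`), one
letter `k₀` strictly above the pivot exponent with `det P_{k₀} = 0`, all others strictly below ⇒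
`Z₊ + 1 ≤ 2·∑_{j odd ≤ min r (m+1)} C(K + m − j, K − 1)` (gen 26's budget minus one). [folklore] -/
theorem negSemidef_pivot_graded_succ_of_lone_above (e : ℕ) (d : Fin K → ℕ) (W : Matrix (Fin (m + 1)) (Fin q) ℝ)
    (P : Fin K → Matrix (Fin (m + 1)) (Fin (m + 1)) ℝ) (hP : ∀ k, (P k).PosSemidef) (hK : 0 < K) (hq : 0 < q) (k₀ : Fin K)
    (htop : e < d k₀) (hlow : ∀ k, k ≠ k₀ → d k < e) (hrk : (P k₀).det = 0) :
    pivotPosRoots e d (-(W * Wᵀ)) P + 1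
      ≤ 2 * ((Finset.range (min q (m + 1) + 1)).filter (fun j => Odd j)).sum (fun j => Nat.choose (K + (m + 1) - j - 1) (K - 1)) := by
  refine negSemidef_pivot_graded_succ_of_top e d W P hP hK hq (Nat.succ_pos m) k₀ (n₀ := e + m * d k₀) (by simp)
    (fun n hn => coeff_det_eq_zero_above e d _ P k₀ htop hlow hrk hn) ?_
  rw [coeff_det_topNext_lone_above e d _ P k₀ htop hlow]
  have hWW : (W * Wᵀ).PosSemidef := by
    simpa [Matrix.conjTranspose_eq_transpose_of_trivial] using Matrix.posSemidef_self_mul_conjTranspose W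
  have h := TrailingCoeffs.trace_adjugate_mul_nonneg (hP k₀) hWW
  rw [Matrix.mul_neg, Matrix.trace_neg]
  linarith

/-- **`(1 | K−1)` with a SINGULAR lone lower letter, any size `m + 1`** (mirror by `x ↦ 1/x`). [folklore] -/
theorem negSemidef_pivot_graded_succ_of_lone_below (e : ℕ) (d : Fin K → ℕ) (W : Matrix (Fin (m + 1)) (Fin q) ℝ)
    (P : Fin K → Matrix (Fin (m + 1)) (Fin (m + 1)) ℝ) (hP : ∀ k, (P k).PosSemidef) (hK : 0 < K) (hq : 0 < q) (k₀ : Fin K)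
    (hbot : d k₀ < e) (hup : ∀ k, k ≠ k₀ → e < d k) (hrk : (P k₀).det = 0) :
    pivotPosRoots e d (-(W * Wᵀ)) P + 1
      ≤ 2 * ((Finset.range (min q (m + 1) + 1)).filter (fun j => Odd j)).sum (fun j => Nat.choose (K + (m + 1) - j - 1) (K - 1)) := by
  classical
  set N : ℕ := e + ∑ k, d k with hN
  have he : e ≤ N := by rw [hN]; exact Nat.le_add_right _ _
  have hdN : ∀ k, d k ≤ N := fun k => by
    rw [hN]
    exact (Finset.single_le_sum (fun i _ => Nat.zero_le (d i)) (Finset.mem_univ k)).trans (Nat.le_add_left _ _)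
  rw [← Reverse.pivotPosRoots_reverse N e d (-(W * Wᵀ)) P he hdN]
  refine negSemidef_pivot_graded_succ_of_lone_above (N - e) (fun k => N - d k) W P hP hK hq k₀ ?_ ?_ hrk
  · have := hdN k₀; omega
  · intro k hk
    have := hup k hk; have := hdN k; omega

/-! ## 4. The W-pencil with `J ⪯ 0` and a singular top letter -/

/-- **W-currency, any size `m + 1`.**  A W-pencil `X^e J + X^{d₁}P₁ + X^{d₂}P₂ + X^{d₃}Q` with `d₂ < d₁ < e < d₃`, `J ⪯ 0`,
`P₁, P₂, Q ⪰ 0` and `det Q = 0` has `Z₊ + 1 ≤ 2·∑_{j odd ≤ m+1} C(m + 3 − j, 2)` — one less than gen 26's `wNsd_le`. [folklore] -/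
theorem wNsd_succ_le_of_singular_top (e d₁ d₂ d₃ : ℕ) (J P₁ P₂ Q : Matrix (Fin (m + 1)) (Fin (m + 1)) ℝ) (hJ : (-J).PosSemidef)
    (hP₁ : P₁.PosSemidef) (hP₂ : P₂.PosSemidef) (hQ : Q.PosSemidef) (h21 : d₂ < d₁) (h1e : d₁ < e) (he3 : e < d₃)
    (hrk : Q.det = 0) :
    ((Matrix.det (((X : ℝ[X]) ^ e) • J.map Polynomial.C
        + ((X : ℝ[X]) ^ d₁) • P₁.map Polynomial.C + ((X : ℝ[X]) ^ d₂) • P₂.map Polynomial.C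
        + ((X : ℝ[X]) ^ d₃) • Q.map Polynomial.C)).roots.toFinset.filter (fun t => 0 < t)).card + 1
      ≤ 2 * ((Finset.range (m + 2)).filter (fun j => Odd j)).sum (fun j => Nat.choose (m + 3 - j) 2) := by
  obtain ⟨W, hW⟩ := ResolventDescartes.exists_eq_mul_transpose (-J) hJ
  have hJ' : J = -(W * Wᵀ) := by rw [← hW, neg_neg]
  have hP : ∀ k : Fin 3, ((![P₁, P₂, Q] : Fin 3 → Matrix (Fin (m + 1)) (Fin (m + 1)) ℝ) k).PosSemidef := by
    intro k; fin_cases k <;> assumption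
  have h := negSemidef_pivot_graded_succ_of_lone_above e (![d₁, d₂, d₃] : Fin 3 → ℕ) W ![P₁, P₂, Q] hP (by norm_num)
    (Nat.succ_pos m) 2 (by simpa using he3) (by intro k hk; fin_cases k <;> simp_all; omega) (by simpa using hrk)
  unfold pivotPosRoots at h
  have hsum : ((X : ℝ[X]) ^ e) • J.map Polynomial.C
        + ((X : ℝ[X]) ^ d₁) • P₁.map Polynomial.C + ((X : ℝ[X]) ^ d₂) • P₂.map Polynomial.C
        + ((X : ℝ[X]) ^ d₃) • Q.map Polynomial.C
      = ((X : ℝ[X]) ^ e) • (-(W * Wᵀ)).map Polynomial.C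
        + ∑ k : Fin 3, ((X : ℝ[X]) ^ (![d₁, d₂, d₃] : Fin 3 → ℕ) k) •
          ((![P₁, P₂, Q] : Fin 3 → Matrix (Fin (m + 1)) (Fin (m + 1)) ℝ) k).map Polynomial.C := by
    rw [Fin.sum_univ_three, ← hJ']
    simp only [Matrix.cons_val_zero, Matrix.cons_val_one, Matrix.cons_val_two, Matrix.head_cons, Matrix.tail_cons]
    abel
  rw [hsum]
  refine h.trans (Nat.mul_le_mul_left 2 ?_)
  have hsub : (Finset.range (min (m + 1) (m + 1) + 1)).filter (fun j => Odd j) ⊆ (Finset.range (m + 2)).filter (fun j => Odd j) := by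
    refine Finset.filter_subset_filter _ (Finset.range_subset_range.mpr ?_)
    omega
  refine (Finset.sum_le_sum_of_subset hsub).trans (Finset.sum_le_sum fun j hj => ?_)
  have hjm : j ≤ m + 1 := by have := Finset.mem_range.mp (Finset.mem_filter.mp hj).1; omega
  rw [show 3 + (m + 1) - j - 1 = m + 3 - j by omega]

/-- **`n = 3`: a W-pencil with `J ⪯ 0` and a SINGULAR top letter has at most `13` positive roots** (`2·(C(5,2) + C(3,2)) − 1`; gen 26's bound
for the full definite sub-column is `14`, and the ten-root witness has a full-rank top letter). [folklore] -/
theorem wNsd_three_le_thirteen_of_singular_top (e d₁ d₂ d₃ : ℕ) (J P₁ P₂ Q : Matrix (Fin 3) (Fin 3) ℝ) (hJ : (-J).PosSemidef)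
    (hP₁ : P₁.PosSemidef) (hP₂ : P₂.PosSemidef) (hQ : Q.PosSemidef) (h21 : d₂ < d₁) (h1e : d₁ < e) (he3 : e < d₃)
    (hrk : Q.det = 0) :
    ((Matrix.det (((X : ℝ[X]) ^ e) • J.map Polynomial.C
        + ((X : ℝ[X]) ^ d₁) • P₁.map Polynomial.C + ((X : ℝ[X]) ^ d₂) • P₂.map Polynomial.C
        + ((X : ℝ[X]) ^ d₃) • Q.map Polynomial.C)).roots.toFinset.filter (fun t => 0 < t)).card ≤ 13 := by
  have h := wNsd_succ_le_of_singular_top (m := 2) e d₁ d₂ d₃ J P₁ P₂ Q hJ hP₁ hP₂ hQ h21 h1e he3 hrk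
  have h14 : 2 * ((Finset.range (2 + 2)).filter (fun j => Odd j)).sum (fun j => Nat.choose (2 + 3 - j) 2) = 14 := by
    rw [Finset.sum_filter, Finset.sum_range_succ, Finset.sum_range_succ, Finset.sum_range_succ, Finset.sum_range_succ,
      Finset.sum_range_zero]
    simp [Nat.odd_iff, Nat.choose]
  rw [h14] at h
  omega

end Summit.ValiantsHypothesis.ValiantsHypothesis.Theorems.LacunarySymmetroidMatrixDescartes.Pivot.NsdLoneSingular
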